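import Summits.QuantumFields.YangMills.Theorems.UnitScaleTiltProp7CovariantCampanatoStep
import Summits.QuantumFields.YangMills.Theorems.UnitScaleTiltProp7CampanatoMorreyDecayEps
import HarnessLib

/-!
# Route `UnitScaleTilt`, crux K1 «MinimiserStabilityRegPr» (stmt-QuantumFields-19200), EX row (5) `h3` (STOREY H), H2 pipeline (ii) — programme **H2-LOC**, brick **(C4b):
# THE COVARIANT MORREY BOUND ON `ℤ^d`** — the covariant Campanato step (C4a) uniformised into the `hstep` shape of px21 g16's ✓`Prop7CampanatoMorreyDecayEps.morrey_decay_eps_pow`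
# (`A₀ = 4·3^d·A_d`, slack `ε = (8A_d+4)·5dδ²(4K)²`, inhomogeneity `B`), the top-scale bound from the covariant Caccioppoli inequality (C1) at radius `2K` with margin `K − 2`, and the
# resulting MORREY DECAY of the covariant energy `φ(ρ) = Σ_{Q_ρ(z)}Σ_μ‖R(y,μ)u(y+e_μ) − u(y)‖² ≤ C_d·N₀·(ρ+1)^{d−1}` (`0 ≤ ρ ≤ 2K`) for a solution of `L_R^κ u = D*_R g + src` on `Q_{3K}(z)`
# whose background is `δ`-close to `1` there — the curved twin of lit ✓`B4Eq19LatticeInteriorHolder.morrey_bound`.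

Cell `ym3-torus` (HUMAN RULING D-0037; rung R3 = SU(2) YM₃ on T³ — NOT d = 4, NOT infinite volume, NOT a mass gap, NOT Clay).  Width seat `ym3-torus-px19` (gen 16);
`--supports stmt-QuantumFields-19200 --as helper`; count-neutral; THEOREMS ONLY (0 `def`, 0 `sorry`, default heartbeats).  Inputs BY NAME: (C4a) ✓`Prop7CovariantCampanatoStep.covariant_campanato_step`,
(C1) ✓p780868 `Prop7CovariantLatticeCaccioppoli.covariant_caccioppoli`, (C3b) ✓p781074 `Prop7CampanatoMorreyDecayEps.morrey_decay_eps_pow` (px21 g16).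

WHAT IS PROVED (ns `Summit.QuantumFields.YangMills.Theorems.Prop7CovariantMorreyBound`; `W` finite-dimensional real inner-product space, `d ≥ 1`; `A_d = 2^d(1+56d)^d(8(d+1))^{d+1}`).
* §1 `one_le_Ad`, ★★`hstep_uniform` — for `K ≥ 1`, the equation on `Q_{2K}(z)`, `‖u‖ ≤ M_u` on `Q_{2K+1}(z)`, `‖g‖ ≤ m`, `‖src‖ ≤ σ`, `‖R − 1‖ ≤ δ` on `Q_{2K}(z)`, `dδ²(4K)² ≤ 1`:
  `∀ 0 ≤ ρ ≤ r ≤ 2K: φ(ρ) ≤ (4A₀((ρ+1)∕(r+1))^d + ε)·φ(r) + B·(r+1)^d` with `A₀ = 4·3^dA_d`, `ε = (8A_d+4)(5dδ²(4K)²)`,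
  `B = 2^d((8A_d+4)·5·(4dm² + (4K)²σ² + 5dδ²M_u²) + (16A_d+2)dδ²M_u²)` (C4a at `(ρ, r−2)` for `r ≥ ρ+2`; monotonicity for `r < ρ+2`).
* §2 ★`top_scale_cov` — for `K ≥ 3`, the equation on `Q_{3K−2}(z)`, `‖u‖ ≤ M_u` on `Q_{3K}(z)`, `‖g‖ ≤ m`, `‖src‖ ≤ σ` on `Q_{3K−1}(z)`:
  `φ(2K) ≤ 126d·7^d·K^{d−2}·M_u² + 4d·6^d·K^d·m² + 2·6^d·K^d·M_uσ`.
* §3 ★★★ `morrey_bound_cov` — under §1+§2's hypotheses and the slack condition `ε(4(4·2^dA₀))^d ≤ 4·2^dA₀`: `∀ 0 ≤ ρ ≤ 2K, φ(ρ) ≤ 2(4(4·2^dA₀))^{2(d−1)}·N₀·(ρ+1)^{d−1}`,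
  `N₀ = 126d7^dM_u²∕K + (4d6^dm² + 2·6^dM_uσ + 3^dB)·K`.
HYP-SAT (★★OWNER RULING №42): equation + sup rows on boxes + two explicit smallness inequalities in `δK` (discharged in (C4c) from `Kδ ≤ θ_d`); inhabited by `0`∕`R ≡ 1`.
HONEST SCOPE: [folklore] ([Giaquinta1984] III §2 Thm 2.2); the Hölder conclusion is (C4c); nothing of `hHlocV`, `hWsup`, H2, `h3`, norm_G, EX, 19200 or the rung is proved; the Yang–Mills mass gap is NOT proved.

References: T. Bałaban, CMP **99** (1985) 389–434 [Balaban1985BackgroundPropagators] (Thm 3.1 (3.43) p.398); CMP **96** (1984) 223–250 [Balaban1984PropagatorsII] ((1.9) p.226);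
M. Giaquinta, *Multiple integrals …* (1983) [Giaquinta1984] (Ch. III §2 Thm 2.2 pp.78–79, §1 Thm 1.2 p.70).
-/

set_option autoImplicit false

noncomputable section

open scoped BigOperators InnerProductSpace
open Finset

namespace Summit.QuantumFields.YangMills.Theorems.Prop7CovariantMorreyBound

open Literature.MathematicalPhysics.QuantumFieldTheory.Balaban1983to89
open B4Eq19LatticeOperators (Zd unitVec box mem_box box_mono add_unitVec_mem_box card_box)
open Summit.QuantumFields.YangMills.Theorems.Prop7CovariantLatticeCaccioppoli (covariant_caccioppoli)
open Summit.QuantumFields.YangMills.Theorems.Prop7CovariantCampanatoStep (covariant_campanato_step)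
open Summit.QuantumFields.YangMills.Theorems.Prop7CampanatoMorreyDecayEps (morrey_decay_eps_pow)

variable {d : ℕ} {W : Type*} [NormedAddCommGroup W] [InnerProductSpace ℝ W]

/-! ## §1 The uniform step -/

/-- `A_d = 2^d(1+56d)^d(8(d+1))^{d+1} ≥ 1`. [folklore] [cite: Giaquinta1984, Ch. III §2 (2.5) p.78] -/
theorem one_le_Ad : (1 : ℝ) ≤ (2 : ℝ) ^ d * (1 + 56 * d) ^ d * (8 * ((d : ℝ) + 1)) ^ (d + 1) := by
  have hd0 : (0 : ℝ) ≤ d := Nat.cast_nonneg d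
  have h1 : (1 : ℝ) ≤ 2 ^ d := one_le_pow₀ (by norm_num)
  have h2 : (1 : ℝ) ≤ (1 + 56 * d) ^ d := one_le_pow₀ (by linarith)
  have h3 : (1 : ℝ) ≤ (8 * ((d : ℝ) + 1)) ^ (d + 1) := one_le_pow₀ (by linarith)
  calc (1 : ℝ) = 1 * 1 * 1 := by ring
    _ ≤ (2 : ℝ) ^ d * (1 + 56 * d) ^ d * (8 * ((d : ℝ) + 1)) ^ (d + 1) := by gcongr

/-- ★★ **THE UNIFORM COVARIANT CAMPANATO STEP** in the shape of ✓`morrey_decay_eps_pow`'s `hstep`: for `K ≥ 1`, `κ > 0`, the equation `L_R^κ u = D*_R g + src` on `Q_{2K}(z)`, `‖u‖ ≤ M_u` on `Q_{2K+1}(z)`,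
`‖g‖ ≤ m`, `‖src‖ ≤ σ`, `‖R(y,μ)x − x‖ ≤ δ‖x‖` on `Q_{2K}(z)`, and `dδ²(4K)² ≤ 1`: for all integers `0 ≤ ρ ≤ r ≤ 2K`,
`φ(ρ) ≤ (4A₀((ρ+1)∕(r+1))^d + ε)·φ(r) + B·(r+1)^d` with `A₀ = 4·3^d·A_d`, `ε = (8A_d+4)(5dδ²(4K)²)`, `B = 2^d((8A_d+4)·5·(4dm² + (4K)²σ² + 5dδ²M_u²) + (16A_d+2)dδ²M_u²)`.
[folklore] [cite: Giaquinta1984, Ch. III §2 Thm 2.2 pp.78–79] -/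
theorem hstep_uniform [FiniteDimensional ℝ W] (hd : 1 ≤ d) (R : Zd d → Fin d → (W ≃ₗᵢ[ℝ] W)) {κ : ℝ} (hκ : 0 < κ)
    (u : Zd d → W) (g : Zd d → Fin d → W) (src : Zd d → W) (z : Zd d) {K : ℕ} (hK : 1 ≤ K)
    {Mu m σ δ : ℝ} (hMu : 0 ≤ Mu) (hm : 0 ≤ m) (hσ : 0 ≤ σ) (hδ : 0 ≤ δ)
    (hEq : ∀ y ∈ box z (2 * (K : ℤ)),
      (∑ μ, ((2 : ℝ) • u y - R y μ (u (y + unitVec μ)) - (R (y - unitVec μ) μ).symm (u (y - unitVec μ)))) + κ • u y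
        = (∑ μ, ((R (y - unitVec μ) μ).symm (g (y - unitVec μ) μ) - g y μ)) + src y)
    (hu : ∀ y ∈ box z (2 * (K : ℤ) + 1), ‖u y‖ ≤ Mu)
    (hg : ∀ y ∈ box z (2 * (K : ℤ)), ∀ μ, ‖g y μ‖ ≤ m)
    (hs : ∀ y ∈ box z (2 * (K : ℤ)), ‖src y‖ ≤ σ)
    (hR : ∀ y ∈ box z (2 * (K : ℤ)), ∀ (μ : Fin d) (x : W), ‖R y μ x - x‖ ≤ δ * ‖x‖)
    (hsmall : (d : ℝ) * δ ^ 2 * (4 * (K : ℝ)) ^ 2 ≤ 1) :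
    ∀ ρ r : ℤ, 0 ≤ ρ → ρ ≤ r → r ≤ 2 * (K : ℤ) →
      ∑ y ∈ box z ρ, ∑ μ, ‖R y μ (u (y + unitVec μ)) - u y‖ ^ 2 ≤
        (4 * (4 * (3 : ℝ) ^ d * ((2 : ℝ) ^ d * (1 + 56 * d) ^ d * (8 * ((d : ℝ) + 1)) ^ (d + 1))) * (((ρ : ℝ) + 1) / ((r : ℝ) + 1)) ^ d
            + (8 * ((2 : ℝ) ^ d * (1 + 56 * d) ^ d * (8 * ((d : ℝ) + 1)) ^ (d + 1)) + 4) * (5 * d * δ ^ 2 * (4 * (K : ℝ)) ^ 2))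
          * ∑ y ∈ box z r, ∑ μ, ‖R y μ (u (y + unitVec μ)) - u y‖ ^ 2
        + (2 : ℝ) ^ d * ((8 * ((2 : ℝ) ^ d * (1 + 56 * d) ^ d * (8 * ((d : ℝ) + 1)) ^ (d + 1)) + 4) * (5 * (4 * d * m ^ 2 + (4 * (K : ℝ)) ^ 2 * σ ^ 2 + 5 * d * δ ^ 2 * Mu ^ 2))
            + (16 * ((2 : ℝ) ^ d * (1 + 56 * d) ^ d * (8 * ((d : ℝ) + 1)) ^ (d + 1)) + 2) * (d * δ ^ 2 * Mu ^ 2)) * ((r : ℝ) + 1) ^ d := by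
  intro ρ r hρ hρr hr2K
  set A : ℝ := (2 : ℝ) ^ d * (1 + 56 * d) ^ d * (8 * ((d : ℝ) + 1)) ^ (d + 1) with hA
  have hA1 : 1 ≤ A := by rw [hA]; exact one_le_Ad
  have hA0 : 0 ≤ A := by linarith
  have hd0 : (0 : ℝ) ≤ d := Nat.cast_nonneg d
  have hρR : (0 : ℝ) ≤ ρ := by exact_mod_cast hρ
  have hρrR : (ρ : ℝ) ≤ r := by exact_mod_cast hρr
  have hr0 : 0 ≤ r := hρ.trans hρr
  have hrR : (0 : ℝ) ≤ r := by exact_mod_cast hr0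
  set φ : ℤ → ℝ := fun s => ∑ y ∈ box z s, ∑ μ, ‖R y μ (u (y + unitVec μ)) - u y‖ ^ 2 with hφ
  have hφ0 : ∀ s, 0 ≤ φ s := fun s => Finset.sum_nonneg fun _ _ => Finset.sum_nonneg fun _ _ => sq_nonneg _
  have hφmono : ∀ s t : ℤ, s ≤ t → φ s ≤ φ t := fun s t hst =>
    Finset.sum_le_sum_of_subset_of_nonneg (box_mono z hst) fun _ _ _ => Finset.sum_nonneg fun _ _ => sq_nonneg _
  set q : ℝ := (((ρ : ℝ) + 1) / ((r : ℝ) + 1)) ^ d with hq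
  have hq0 : 0 ≤ q := by rw [hq]; positivity
  set ε : ℝ := (8 * A + 4) * (5 * d * δ ^ 2 * (4 * (K : ℝ)) ^ 2) with hε
  have hε0 : 0 ≤ ε := by rw [hε]; positivity
  set B : ℝ := (2 : ℝ) ^ d * ((8 * A + 4) * (5 * (4 * d * m ^ 2 + (4 * (K : ℝ)) ^ 2 * σ ^ 2 + 5 * d * δ ^ 2 * Mu ^ 2)) + (16 * A + 2) * (d * δ ^ 2 * Mu ^ 2)) with hB
  have hB0 : 0 ≤ B := by rw [hB]; positivity
  show φ ρ ≤ (4 * (4 * (3 : ℝ) ^ d * A) * q + ε) * φ r + B * ((r : ℝ) + 1) ^ d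
  have hr1 : (0 : ℝ) < (r : ℝ) + 1 := by linarith
  by_cases hcase : ρ + 2 ≤ r
  · -- the genuine step at `(ρ, r − 2)`
    have hρr' : ρ ≤ r - 2 := by linarith
    have h2 : (2 : ℤ) ≤ r := by linarith
    have hN : ((2 * (r - 2) + 4 : ℤ) : ℝ) = 2 * (r : ℝ) := by push_cast; ring
    have hNle : 2 * (r : ℝ) ≤ 4 * (K : ℝ) := by
      have : (r : ℝ) ≤ 2 * (K : ℝ) := by exact_mod_cast hr2K
      linarith
    have hsmall' : (d : ℝ) * δ ^ 2 * ((2 * (r - 2) + 4 : ℤ) : ℝ) ^ 2 ≤ 1 := by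
      rw [hN]
      calc (d : ℝ) * δ ^ 2 * (2 * (r : ℝ)) ^ 2 ≤ (d : ℝ) * δ ^ 2 * (4 * (K : ℝ)) ^ 2 := by gcongr
        _ ≤ 1 := hsmall
    have hstep := covariant_campanato_step hd R hκ u g src z hρ hρr' hMu hm hσ hδ
      (fun y hy => hEq y (box_mono z (by linarith) hy)) (fun y hy => hu y (box_mono z (by linarith) hy))
      (fun y hy => hg y (box_mono z (by linarith) hy)) (fun y hy => hs y (box_mono z (by linarith) hy))
      (fun y hy => hR y (box_mono z (by linarith) hy)) hsmall'
    rw [← hA, hN, show r - 2 + 2 = r by ring] at hstep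
    have hV : ((2 * r + 1 : ℤ) : ℝ) = 2 * (r : ℝ) + 1 := by push_cast; ring
    rw [hV] at hstep
    -- compare the coefficients
    have hr2 : (2 : ℝ) ≤ r := by exact_mod_cast h2
    have ecast : (((r - 2 : ℤ) : ℝ) + 1) = (r : ℝ) - 1 := by push_cast; ring
    have hbase : ((ρ : ℝ) + 1) / (((r - 2 : ℤ) : ℝ) + 1) ≤ 3 * (((ρ : ℝ) + 1) / ((r : ℝ) + 1)) := by
      rw [ecast, div_le_iff₀ (by linarith : (0 : ℝ) < (r : ℝ) - 1),
        show 3 * (((ρ : ℝ) + 1) / ((r : ℝ) + 1)) * ((r : ℝ) - 1) = ((ρ : ℝ) + 1) * (3 * ((r : ℝ) - 1) / ((r : ℝ) + 1)) by ring]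
      have hX : 1 ≤ 3 * ((r : ℝ) - 1) / ((r : ℝ) + 1) := by rw [le_div_iff₀ hr1]; linarith
      exact le_mul_of_one_le_right (by linarith) hX
    have hq' : (((ρ : ℝ) + 1) / (((r - 2 : ℤ) : ℝ) + 1)) ^ d ≤ (3 : ℝ) ^ d * q := by
      have h0 : 0 ≤ ((ρ : ℝ) + 1) / (((r - 2 : ℤ) : ℝ) + 1) := by rw [ecast]; exact div_nonneg (by linarith) (by linarith)
      calc (((ρ : ℝ) + 1) / (((r - 2 : ℤ) : ℝ) + 1)) ^ d ≤ (3 * (((ρ : ℝ) + 1) / ((r : ℝ) + 1))) ^ d := pow_le_pow_left₀ h0 hbase _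
        _ = (3 : ℝ) ^ d * q := by rw [mul_pow, hq]
    have hc1 : 16 * A * (((ρ : ℝ) + 1) / (((r - 2 : ℤ) : ℝ) + 1)) ^ d ≤ 4 * (4 * (3 : ℝ) ^ d * A) * q := by
      calc 16 * A * (((ρ : ℝ) + 1) / (((r - 2 : ℤ) : ℝ) + 1)) ^ d ≤ 16 * A * ((3 : ℝ) ^ d * q) := mul_le_mul_of_nonneg_left hq' (by positivity)
        _ = 4 * (4 * (3 : ℝ) ^ d * A) * q := by ring
    have hc2 : (8 * A + 4) * (5 * d * δ ^ 2 * (2 * (r : ℝ)) ^ 2) ≤ ε := by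
      rw [hε]; apply mul_le_mul_of_nonneg_left _ (by positivity); gcongr
    have hc3 : (2 * (r : ℝ) + 1) ^ d ≤ (2 : ℝ) ^ d * ((r : ℝ) + 1) ^ d := by
      rw [← mul_pow]; exact pow_le_pow_left₀ (by linarith) (by linarith) _
    have hc4 : (8 * A + 4) * (5 * (4 * d * m ^ 2 + (2 * (r : ℝ)) ^ 2 * σ ^ 2 + 5 * d * δ ^ 2 * Mu ^ 2)) + (16 * A + 2) * (d * δ ^ 2 * Mu ^ 2)
        ≤ (8 * A + 4) * (5 * (4 * d * m ^ 2 + (4 * (K : ℝ)) ^ 2 * σ ^ 2 + 5 * d * δ ^ 2 * Mu ^ 2)) + (16 * A + 2) * (d * δ ^ 2 * Mu ^ 2) := by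
      gcongr
    have hin0 : 0 ≤ (8 * A + 4) * (5 * (4 * d * m ^ 2 + (2 * (r : ℝ)) ^ 2 * σ ^ 2 + 5 * d * δ ^ 2 * Mu ^ 2)) + (16 * A + 2) * (d * δ ^ 2 * Mu ^ 2) := by positivity
    calc φ ρ ≤ (16 * A * (((ρ : ℝ) + 1) / (((r - 2 : ℤ) : ℝ) + 1)) ^ d + (8 * A + 4) * (5 * d * δ ^ 2 * (2 * (r : ℝ)) ^ 2)) * φ r
          + (2 * (r : ℝ) + 1) ^ d * ((8 * A + 4) * (5 * (4 * d * m ^ 2 + (2 * (r : ℝ)) ^ 2 * σ ^ 2 + 5 * d * δ ^ 2 * Mu ^ 2)) + (16 * A + 2) * (d * δ ^ 2 * Mu ^ 2)) := hstep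
      _ ≤ (4 * (4 * (3 : ℝ) ^ d * A) * q + ε) * φ r
          + ((2 : ℝ) ^ d * ((r : ℝ) + 1) ^ d) * ((8 * A + 4) * (5 * (4 * d * m ^ 2 + (4 * (K : ℝ)) ^ 2 * σ ^ 2 + 5 * d * δ ^ 2 * Mu ^ 2)) + (16 * A + 2) * (d * δ ^ 2 * Mu ^ 2)) := by
          have a1 := mul_le_mul_of_nonneg_right (add_le_add hc1 hc2) (hφ0 r)
          have a2 := mul_le_mul hc3 hc4 hin0 (by positivity)
          linarith
      _ = (4 * (4 * (3 : ℝ) ^ d * A) * q + ε) * φ r + B * ((r : ℝ) + 1) ^ d := by rw [hB]; ring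
  · -- `r ∈ {ρ, ρ+1}`: monotonicity and `4A₀q ≥ 1`
    have hrle : r ≤ ρ + 1 := by linarith
    have hq1 : (1 / 2 : ℝ) ^ d ≤ q := by
      rw [hq]
      apply pow_le_pow_left₀ (by norm_num)
      rw [le_div_iff₀ hr1]
      have : (r : ℝ) ≤ ρ + 1 := by exact_mod_cast hrle
      linarith
    have hcoef : 1 ≤ 4 * (4 * (3 : ℝ) ^ d * A) * q := by
      have h32 : (1 : ℝ) ≤ (3 : ℝ) ^ d * (1 / 2 : ℝ) ^ d := by rw [← mul_pow]; exact one_le_pow₀ (by norm_num)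
      have h3q : (3 : ℝ) ^ d * (1 / 2 : ℝ) ^ d ≤ (3 : ℝ) ^ d * q := mul_le_mul_of_nonneg_left hq1 (by positivity)
      have h16 : (1 : ℝ) ≤ 16 * A := by linarith
      calc (1 : ℝ) ≤ (3 : ℝ) ^ d * q := h32.trans h3q
        _ ≤ 16 * A * ((3 : ℝ) ^ d * q) := le_mul_of_one_le_left (by positivity) h16
        _ = 4 * (4 * (3 : ℝ) ^ d * A) * q := by ring
    have hBr : 0 ≤ B * ((r : ℝ) + 1) ^ d := mul_nonneg hB0 (pow_nonneg (by linarith) _)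
    calc φ ρ ≤ φ r := hφmono ρ r hρr
      _ = 1 * φ r + 0 := by ring
      _ ≤ (4 * (4 * (3 : ℝ) ^ d * A) * q + ε) * φ r + B * ((r : ℝ) + 1) ^ d :=
          add_le_add (mul_le_mul_of_nonneg_right (by linarith) (hφ0 r)) hBr

/-! ## §2 The top scale -/

/-- `K^d = K^{d−1}·K` for `d ≥ 1`. [folklore] [cite: Giaquinta1984, Ch. III §2 p.77] -/
theorem pow_eq_pow_pred_mul (hd : 1 ≤ d) (x : ℝ) : x ^ d = x ^ (d - 1) * x := by
  rw [← pow_succ]; congr 1; omega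

/-- ★ **THE TOP SCALE** (lit ✓`top_scale_bound`'s covariant twin): for `d ≥ 1`, `K ≥ 3`, `κ ≥ 0`, the equation on `Q_{3K−2}(z)`, `‖u‖ ≤ M_u` on `Q_{3K}(z)`, `‖g‖ ≤ m` and `‖src‖ ≤ σ`
on `Q_{3K−1}(z)`: `φ(2K) ≤ (126d·7^d·M_u²∕K + (4d·6^d·m² + 2·6^d·M_uσ)·K)·K^{d−1}` ((C1) with `ρ = 2K`, `s = K − 2 ≥ K∕3`). [folklore] [cite: Giaquinta1984, Ch. III §2 (2.4) p.77] -/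
theorem top_scale_cov (hd : 1 ≤ d) (R : Zd d → Fin d → (W ≃ₗᵢ[ℝ] W)) {κ : ℝ} (hκ : 0 ≤ κ) (u : Zd d → W) (g : Zd d → Fin d → W) (src : Zd d → W) (z : Zd d)
    {K : ℕ} (hK : 3 ≤ K) {Mu m σ : ℝ} (hMu : 0 ≤ Mu) (hσ : 0 ≤ σ)
    (hEq : ∀ y ∈ box z (3 * (K : ℤ) - 2),
      (∑ μ, ((2 : ℝ) • u y - R y μ (u (y + unitVec μ)) - (R (y - unitVec μ) μ).symm (u (y - unitVec μ)))) + κ • u y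
        = (∑ μ, ((R (y - unitVec μ) μ).symm (g (y - unitVec μ) μ) - g y μ)) + src y)
    (hu : ∀ y ∈ box z (3 * (K : ℤ)), ‖u y‖ ≤ Mu)
    (hg : ∀ y ∈ box z (3 * (K : ℤ) - 1), ∀ μ, ‖g y μ‖ ≤ m)
    (hs : ∀ y ∈ box z (3 * (K : ℤ) - 1), ‖src y‖ ≤ σ) :
    ∑ y ∈ box z (2 * (K : ℤ)), ∑ μ, ‖R y μ (u (y + unitVec μ)) - u y‖ ^ 2 ≤
      (126 * d * (7 : ℝ) ^ d * Mu ^ 2 / (K : ℝ) + (4 * d * (6 : ℝ) ^ d * m ^ 2 + 2 * (6 : ℝ) ^ d * (Mu * σ)) * (K : ℝ)) * (K : ℝ) ^ (d - 1) := by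
  have hK3 : (3 : ℝ) ≤ K := by exact_mod_cast hK
  have hKZ : (3 : ℤ) ≤ K := by exact_mod_cast hK
  have hK0 : (0 : ℝ) < K := by linarith
  have hd0 : (0 : ℝ) ≤ d := Nat.cast_nonneg d
  have hKd : (K : ℝ) ^ d = (K : ℝ) ^ (d - 1) * (K : ℝ) := pow_eq_pow_pred_mul hd _
  have hKp0 : 0 ≤ (K : ℝ) ^ (d - 1) := by positivity
  have h := covariant_caccioppoli R hκ u g src z (ρ := 2 * (K : ℤ)) (s := (K : ℤ) - 2) (by linarith) (by linarith)
    (fun y hy => hEq y (by rwa [show 2 * (K : ℤ) + ((K : ℤ) - 2) = 3 * (K : ℤ) - 2 by ring] at hy))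
  rw [show 2 * (K : ℤ) + ((K : ℤ) - 2) + 2 = 3 * (K : ℤ) by ring, show 2 * (K : ℤ) + ((K : ℤ) - 2) + 1 = 3 * (K : ℤ) - 1 by ring] at h
  -- the three sums
  have hU : ∑ y ∈ box z (3 * (K : ℤ)), ‖u y‖ ^ 2 ≤ (7 : ℝ) ^ d * ((K : ℝ) ^ (d - 1) * (K : ℝ)) * Mu ^ 2 := by
    have h1 : ∑ y ∈ box z (3 * (K : ℤ)), ‖u y‖ ^ 2 ≤ ∑ _y ∈ box z (3 * (K : ℤ)), Mu ^ 2 := Finset.sum_le_sum fun y hy => pow_le_pow_left₀ (norm_nonneg _) (hu y hy) 2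
    rw [Finset.sum_const, nsmul_eq_mul, card_box z (by linarith)] at h1
    have h2 : ((2 * (3 * (K : ℤ)) + 1 : ℤ) : ℝ) ^ d ≤ (7 * (K : ℝ)) ^ d := pow_le_pow_left₀ (by push_cast; linarith) (by push_cast; linarith) _
    rw [mul_pow, hKd] at h2
    exact h1.trans (mul_le_mul_of_nonneg_right h2 (sq_nonneg _))
  have hG : ∑ y ∈ box z (3 * (K : ℤ) - 1), ∑ μ, ‖g y μ‖ ^ 2 ≤ d * ((6 : ℝ) ^ d * ((K : ℝ) ^ (d - 1) * (K : ℝ))) * m ^ 2 := by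
    have h1 : ∑ y ∈ box z (3 * (K : ℤ) - 1), ∑ μ, ‖g y μ‖ ^ 2 ≤ ∑ _y ∈ box z (3 * (K : ℤ) - 1), ∑ _μ : Fin d, m ^ 2 :=
      Finset.sum_le_sum fun y hy => Finset.sum_le_sum fun μ _ => pow_le_pow_left₀ (norm_nonneg _) (hg y hy μ) 2
    simp only [Finset.sum_const, Finset.card_univ, Fintype.card_fin, nsmul_eq_mul] at h1
    rw [card_box z (by linarith)] at h1
    have h2 : ((2 * (3 * (K : ℤ) - 1) + 1 : ℤ) : ℝ) ^ d ≤ (6 * (K : ℝ)) ^ d := pow_le_pow_left₀ (by push_cast; linarith) (by push_cast; linarith) _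
    rw [mul_pow, hKd] at h2
    calc _ ≤ ((2 * (3 * (K : ℤ) - 1) + 1 : ℤ) : ℝ) ^ d * ((d : ℝ) * m ^ 2) := h1
      _ ≤ ((6 : ℝ) ^ d * ((K : ℝ) ^ (d - 1) * (K : ℝ))) * ((d : ℝ) * m ^ 2) := mul_le_mul_of_nonneg_right h2 (by positivity)
      _ = d * ((6 : ℝ) ^ d * ((K : ℝ) ^ (d - 1) * (K : ℝ))) * m ^ 2 := by ring
  have hS : ∑ y ∈ box z (3 * (K : ℤ) - 1), ‖u y‖ * ‖src y‖ ≤ ((6 : ℝ) ^ d * ((K : ℝ) ^ (d - 1) * (K : ℝ))) * (Mu * σ) := by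
    have h1 : ∑ y ∈ box z (3 * (K : ℤ) - 1), ‖u y‖ * ‖src y‖ ≤ ∑ _y ∈ box z (3 * (K : ℤ) - 1), Mu * σ :=
      Finset.sum_le_sum fun y hy => mul_le_mul (hu y (box_mono z (by linarith) hy)) (hs y hy) (norm_nonneg _) hMu
    rw [Finset.sum_const, nsmul_eq_mul, card_box z (by linarith)] at h1
    have h2 : ((2 * (3 * (K : ℤ) - 1) + 1 : ℤ) : ℝ) ^ d ≤ (6 * (K : ℝ)) ^ d := pow_le_pow_left₀ (by push_cast; linarith) (by push_cast; linarith) _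
    rw [mul_pow, hKd] at h2
    exact h1.trans (mul_le_mul_of_nonneg_right h2 (mul_nonneg hMu hσ))
  -- the Caccioppoli prefactor: `14d/(K−2)² · 7^d K^{d−1} K Mu² ≤ 126 d 7^d Mu²/K · K^{d−1}`
  have hK2 : (0 : ℝ) < (K : ℝ) - 2 := by linarith
  have e1 : (((K : ℤ) - 2 : ℤ) : ℝ) = (K : ℝ) - 2 := by push_cast; ring
  have hpref : 14 * (d : ℝ) / (((K : ℤ) - 2 : ℤ) : ℝ) ^ 2 * ((7 : ℝ) ^ d * ((K : ℝ) ^ (d - 1) * (K : ℝ)) * Mu ^ 2)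
      ≤ 126 * d * (7 : ℝ) ^ d * Mu ^ 2 / (K : ℝ) * (K : ℝ) ^ (d - 1) := by
    rw [e1]
    -- `14 K/(K-2)² ≤ 126/K`
    have hkey : 14 * (K : ℝ) / ((K : ℝ) - 2) ^ 2 ≤ 126 / (K : ℝ) := by
      rw [div_le_div_iff₀ (pow_pos hK2 2) hK0]
      nlinarith
    have hX0 : 0 ≤ (d : ℝ) * (7 : ℝ) ^ d * (K : ℝ) ^ (d - 1) * Mu ^ 2 := by positivity
    have := mul_le_mul_of_nonneg_left hkey hX0
    have e2 : 14 * (d : ℝ) / ((K : ℝ) - 2) ^ 2 * ((7 : ℝ) ^ d * ((K : ℝ) ^ (d - 1) * (K : ℝ)) * Mu ^ 2)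
        = (d : ℝ) * (7 : ℝ) ^ d * (K : ℝ) ^ (d - 1) * Mu ^ 2 * (14 * (K : ℝ) / ((K : ℝ) - 2) ^ 2) := by ring
    have e3 : 126 * d * (7 : ℝ) ^ d * Mu ^ 2 / (K : ℝ) * (K : ℝ) ^ (d - 1) = (d : ℝ) * (7 : ℝ) ^ d * (K : ℝ) ^ (d - 1) * Mu ^ 2 * (126 / (K : ℝ)) := by ring
    rw [e2, e3]; exact this
  have hc0 : 0 ≤ 14 * (d : ℝ) / (((K : ℤ) - 2 : ℤ) : ℝ) ^ 2 := by rw [e1]; positivity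
  have a1 := mul_le_mul_of_nonneg_left hU hc0
  calc _ ≤ 14 * (d : ℝ) / (((K : ℤ) - 2 : ℤ) : ℝ) ^ 2 * ∑ y ∈ box z (3 * (K : ℤ)), ‖u y‖ ^ 2 + 4 * ∑ y ∈ box z (3 * (K : ℤ) - 1), ∑ μ, ‖g y μ‖ ^ 2
        + 2 * ∑ y ∈ box z (3 * (K : ℤ) - 1), ‖u y‖ * ‖src y‖ := h
    _ ≤ 126 * d * (7 : ℝ) ^ d * Mu ^ 2 / (K : ℝ) * (K : ℝ) ^ (d - 1) + 4 * (d * ((6 : ℝ) ^ d * ((K : ℝ) ^ (d - 1) * (K : ℝ))) * m ^ 2)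
        + 2 * (((6 : ℝ) ^ d * ((K : ℝ) ^ (d - 1) * (K : ℝ))) * (Mu * σ)) := by linarith
    _ = _ := by ring

/-! ## §3 ★★★ The covariant Morrey bound -/

/-- ★★★ **THE COVARIANT MORREY BOUND ON `ℤ^d`.**  For `d ≥ 1`, `K ≥ 3`, `κ > 0`, the equation `L_R^κ u = D*_R g + src` on `Q_{3K}(z)`, `‖u‖ ≤ M_u` on `Q_{3K}(z)`, `‖g‖ ≤ m`, `‖src‖ ≤ σ`,
`‖R(y,μ)x − x‖ ≤ δ‖x‖` on `Q_{3K}(z)`, the smallness `dδ²(4K)² ≤ 1` and the slack condition `ε·(4(4·2^dA₀))^d ≤ 4·2^dA₀` (`ε = (8A_d+4)(5dδ²(4K)²)`, `A₀ = 4·3^dA_d`): for every integer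
`0 ≤ ρ ≤ 2K`, `Σ_{Q_ρ(z)}Σ_μ‖R(y,μ)u(y+e_μ) − u(y)‖² ≤ 2(4(4·2^dA₀))^{2(d−1)}·N₀·(ρ+1)^{d−1}` with
`N₀ = 126d7^dM_u²∕K + (4d6^dm² + 2·6^dM_uσ + 3^dB)·K`, `B = 2^d((8A_d+4)·5·(4dm² + (4K)²σ² + 5dδ²M_u²) + (16A_d+2)dδ²M_u²)` (§1 + §2 fed to px21 g16's ✓`morrey_decay_eps_pow`).
[folklore] [cite: Giaquinta1984, Ch. III §2 Thm 2.2 p.78, §1 Thm 1.2 p.70; Balaban1985BackgroundPropagators, Thm 3.1 (3.43) p.398] -/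
theorem morrey_bound_cov [FiniteDimensional ℝ W] (hd : 1 ≤ d) (R : Zd d → Fin d → (W ≃ₗᵢ[ℝ] W)) {κ : ℝ} (hκ : 0 < κ)
    (u : Zd d → W) (g : Zd d → Fin d → W) (src : Zd d → W) (z : Zd d) {K : ℕ} (hK : 3 ≤ K)
    {Mu m σ δ : ℝ} (hMu : 0 ≤ Mu) (hm : 0 ≤ m) (hσ : 0 ≤ σ) (hδ : 0 ≤ δ)
    (hEq : ∀ y ∈ box z (3 * (K : ℤ)),
      (∑ μ, ((2 : ℝ) • u y - R y μ (u (y + unitVec μ)) - (R (y - unitVec μ) μ).symm (u (y - unitVec μ)))) + κ • u y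
        = (∑ μ, ((R (y - unitVec μ) μ).symm (g (y - unitVec μ) μ) - g y μ)) + src y)
    (hu : ∀ y ∈ box z (3 * (K : ℤ)), ‖u y‖ ≤ Mu)
    (hg : ∀ y ∈ box z (3 * (K : ℤ)), ∀ μ, ‖g y μ‖ ≤ m)
    (hs : ∀ y ∈ box z (3 * (K : ℤ)), ‖src y‖ ≤ σ)
    (hR : ∀ y ∈ box z (3 * (K : ℤ)), ∀ (μ : Fin d) (x : W), ‖R y μ x - x‖ ≤ δ * ‖x‖)
    (hsmall : (d : ℝ) * δ ^ 2 * (4 * (K : ℝ)) ^ 2 ≤ 1)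
    (hslack : ((8 * ((2 : ℝ) ^ d * (1 + 56 * d) ^ d * (8 * ((d : ℝ) + 1)) ^ (d + 1)) + 4) * (5 * d * δ ^ 2 * (4 * (K : ℝ)) ^ 2))
        * (4 * (4 * (2 : ℝ) ^ d * (4 * (3 : ℝ) ^ d * ((2 : ℝ) ^ d * (1 + 56 * d) ^ d * (8 * ((d : ℝ) + 1)) ^ (d + 1))))) ^ d
      ≤ 4 * (2 : ℝ) ^ d * (4 * (3 : ℝ) ^ d * ((2 : ℝ) ^ d * (1 + 56 * d) ^ d * (8 * ((d : ℝ) + 1)) ^ (d + 1)))) :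
    ∀ ρ : ℤ, 0 ≤ ρ → ρ ≤ 2 * (K : ℤ) →
      ∑ y ∈ box z ρ, ∑ μ, ‖R y μ (u (y + unitVec μ)) - u y‖ ^ 2 ≤
        2 * (4 * (4 * (2 : ℝ) ^ d * (4 * (3 : ℝ) ^ d * ((2 : ℝ) ^ d * (1 + 56 * d) ^ d * (8 * ((d : ℝ) + 1)) ^ (d + 1))))) ^ (2 * (d - 1))
          * (126 * d * (7 : ℝ) ^ d * Mu ^ 2 / (K : ℝ)
              + (4 * d * (6 : ℝ) ^ d * m ^ 2 + 2 * (6 : ℝ) ^ d * (Mu * σ)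
                 + (3 : ℝ) ^ d * ((2 : ℝ) ^ d * ((8 * ((2 : ℝ) ^ d * (1 + 56 * d) ^ d * (8 * ((d : ℝ) + 1)) ^ (d + 1)) + 4) * (5 * (4 * d * m ^ 2 + (4 * (K : ℝ)) ^ 2 * σ ^ 2 + 5 * d * δ ^ 2 * Mu ^ 2))
                    + (16 * ((2 : ℝ) ^ d * (1 + 56 * d) ^ d * (8 * ((d : ℝ) + 1)) ^ (d + 1)) + 2) * (d * δ ^ 2 * Mu ^ 2)))) * (K : ℝ))
          * ((ρ : ℝ) + 1) ^ (d - 1) := by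
  set A : ℝ := (2 : ℝ) ^ d * (1 + 56 * d) ^ d * (8 * ((d : ℝ) + 1)) ^ (d + 1) with hA
  have hA1 : 1 ≤ A := by rw [hA]; exact one_le_Ad
  have hK1 : 1 ≤ K := le_trans (by norm_num) hK
  have hK3 : (3 : ℝ) ≤ K := by exact_mod_cast hK
  have hK0 : (0 : ℝ) < K := by linarith
  have hd0 : (0 : ℝ) ≤ d := Nat.cast_nonneg d
  set A₀ : ℝ := 4 * (3 : ℝ) ^ d * A with hA₀
  have hA₀1 : 1 ≤ A₀ := by
    rw [hA₀]
    have h3 : (1 : ℝ) ≤ (3 : ℝ) ^ d := one_le_pow₀ (by norm_num)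
    calc (1 : ℝ) ≤ 4 * 1 * 1 := by norm_num
      _ ≤ 4 * (3 : ℝ) ^ d * A := by gcongr
  set ε : ℝ := (8 * A + 4) * (5 * d * δ ^ 2 * (4 * (K : ℝ)) ^ 2) with hε
  set B : ℝ := (2 : ℝ) ^ d * ((8 * A + 4) * (5 * (4 * d * m ^ 2 + (4 * (K : ℝ)) ^ 2 * σ ^ 2 + 5 * d * δ ^ 2 * Mu ^ 2)) + (16 * A + 2) * (d * δ ^ 2 * Mu ^ 2)) with hB
  have hB0 : 0 ≤ B := by rw [hB]; positivity
  set N₀ : ℝ := 126 * d * (7 : ℝ) ^ d * Mu ^ 2 / (K : ℝ) + (4 * d * (6 : ℝ) ^ d * m ^ 2 + 2 * (6 : ℝ) ^ d * (Mu * σ) + (3 : ℝ) ^ d * B) * (K : ℝ) with hN₀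
  have hN₀0 : 0 ≤ N₀ := by rw [hN₀]; positivity
  set φ : ℤ → ℝ := fun s => ∑ y ∈ box z s, ∑ μ, ‖R y μ (u (y + unitVec μ)) - u y‖ ^ 2 with hφ
  have hφ0 : ∀ s : ℤ, 0 ≤ s → 0 ≤ φ s := fun s _ => Finset.sum_nonneg fun _ _ => Finset.sum_nonneg fun _ _ => sq_nonneg _
  have hφmono : ∀ s t : ℤ, 0 ≤ s → s ≤ t → φ s ≤ φ t := fun s t _ hst =>
    Finset.sum_le_sum_of_subset_of_nonneg (box_mono z hst) fun _ _ _ => Finset.sum_nonneg fun _ _ => sq_nonneg _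
  -- the step (§1) on the boxes of §3
  have hKZ : (3 : ℤ) ≤ K := by exact_mod_cast hK
  have hstep := hstep_uniform hd R hκ u g src z hK1 hMu hm hσ hδ
    (fun y hy => hEq y (box_mono z (by linarith) hy)) (fun y hy => hu y (box_mono z (by linarith) hy))
    (fun y hy => hg y (box_mono z (by linarith) hy)) (fun y hy => hs y (box_mono z (by linarith) hy))
    (fun y hy => hR y (box_mono z (by linarith) hy)) hsmall
  rw [← hA] at hstep
  -- the top scale (§2)
  have htop₀ := top_scale_cov hd R hκ.le u g src z hK hMu hσ
    (fun y hy => hEq y (box_mono z (by linarith) hy)) hu (fun y hy => hg y (box_mono z (by linarith) hy)) (fun y hy => hs y (box_mono z (by linarith) hy))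
  have htop : φ (2 * (K : ℤ)) + B * (2 * (K : ℝ) + 1) ^ d ≤ N₀ * (K : ℝ) ^ (d - 1) := by
    have hKd : (K : ℝ) ^ d = (K : ℝ) ^ (d - 1) * (K : ℝ) := pow_eq_pow_pred_mul hd _
    have h1 : (2 * (K : ℝ) + 1) ^ d ≤ (3 : ℝ) ^ d * ((K : ℝ) ^ (d - 1) * (K : ℝ)) := by
      rw [← hKd, ← mul_pow]; exact pow_le_pow_left₀ (by linarith) (by linarith) _
    have h2 : B * (2 * (K : ℝ) + 1) ^ d ≤ B * ((3 : ℝ) ^ d * ((K : ℝ) ^ (d - 1) * (K : ℝ))) := mul_le_mul_of_nonneg_left h1 hB0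
    have e : N₀ * (K : ℝ) ^ (d - 1) = (126 * d * (7 : ℝ) ^ d * Mu ^ 2 / (K : ℝ) + (4 * d * (6 : ℝ) ^ d * m ^ 2 + 2 * (6 : ℝ) ^ d * (Mu * σ)) * (K : ℝ)) * (K : ℝ) ^ (d - 1)
        + B * ((3 : ℝ) ^ d * ((K : ℝ) ^ (d - 1) * (K : ℝ))) := by rw [hN₀]; ring
    rw [e]
    exact add_le_add htop₀ h2
  -- the slack
  have hslack' : ε * (4 * (4 * (2 : ℝ) ^ d * A₀)) ^ d ≤ 4 * (2 : ℝ) ^ d * A₀ := by rw [hε, hA₀]; exact hslack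
  -- px21 g16's iteration
  have hmain := morrey_decay_eps_pow (φ := φ) hd hK1 hA₀1 hB0 hN₀0 hslack' hφ0 hφmono
    (fun ρ r hρ hρr hr => hstep ρ r hρ hρr hr) htop
  intro ρ hρ hρK
  have h := hmain ρ hρ hρK
  simp only [hA₀, hN₀, hB, hφ] at h
  exact h

end Summit.QuantumFields.YangMills.Theorems.Prop7CovariantMorreyBound

end
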